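import Summits.BirchSwinnertonDyer.BirchSwinnertonDyer.Theorems.PrintX10bTwoSidedLinkAnyClassNumberX10bOfPrintFacts
import HarnessLib

/-!
# The PINNED, class-number-free Yan–Zhu ∘ BCS ∘ CGLS composite at the trivial character (turnkey for
# `TwoSidedLinkAnyClassNumberX10bPinned[OfPrint]`, PIN-1 / REF-104): Howard's containment for a Heegner
# family whose parametrisation has `p`-ADIC-UNIT Manin constant, the transfer `h59gp` = Yan–Zhu 2026
# Thm. 5.9 (2) ⟹ (1) at the trivial localisation READ PINNED (`¬ (p : ℤ) ∣ F.Dt.c`) AND WITHOUT `p ∤ h_K`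

Cell `run/shared/lean/pub/bsd-print-x9/`, seat `bsd-line-x10b-p3` (D-0154 row 10; crux stmt-BirchSwinnertonDyer-23730,
line `composite-transfer-x10b`). HONEST FRAMING: theorems only (no definition, no named fact, no `sorry`);
`--supports stmt-BirchSwinnertonDyer-23730` (helper); route-independent (no `Theses` import); nothing is
closed; BSD is not proved by any of this and no summit statement is proved by this seat.

## Why this file (PIN-1, plan g9 05:20Z; REF-104, ref g5 05:41Z)

The cell ruled that the layout `∃ (F : HeegnerFamily …), heegnerCharIdeal D F ^ 2 ≤ char(torsion X.X)` with
`F.Dt` free is μ-BLIND (rescaling `F ↦ p^a • F` multiplies `I(ℋ_F)` by `p^a`), so facts taking it as a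
HYPOTHESIS overclaim against print unless PINNED by print's normalisation `¬ (p : ℤ) ∣ F.Dt.c` (Perrin-Riou
1987 §1 Conj. B's `c_π`, BCK21 Conj. 1.1, Mazur 1978), and REF-104 asked that this seat's transfer
hypothesis `h59g` (companion `…OfPrintFacts.lean`, p607253) carry the pin. This file is that re-run,
letter for letter: the transfer hypothesis `h59gp` is "(T2)-general" = Yan–Zhu Thm. 5.9, second bullet ⟹
first bullet at `S ⊂ (Λ_K⁻)ˣ`, for families with `¬ (p : ℤ) ∣ F.Dt.c`, on the binder list of
`thm57_isTorsion_charIdealXGr_eq_bdpLFunction` + `jbar` + `N = N_E`, with NO class-number binder (Yan–Zhu's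
§5.2 setting has none; the tree's typed `thm59_…` adds `p ∤ h_K` only as the Heegner-family vocabulary's
standing hypothesis, `-- TODO(general form)`); the containment hypothesis is pinned the same way
(`∃ jbar D F X, ¬ (p : ℤ) ∣ F.Dt.c ∧ …`, the shape of the WANTED fact (T1)).

* §1 `composite_of_printFacts_of_pinnedTransfer` — from `h57` (Yan–Zhu Thm. 5.7 (1), rational), `h59gp`,
  `h422` (BCS Prop. 4.2.2), `h513` (CGLS Thm. 5.1.3), `hC` (Carayol): the conclusion of the WANTED pinned
  composite (T1) WITH `¬ p ∣ h_K` DELETED — i.e. (T1)-general is DERIVED, not a new fact, once (T2)-general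
  is typed: `𝒳_Gr` torsion, a generator `F`, `F(0) = u·c(Dt)⁻²(1 − a_p p⁻¹ + p⁻¹)² log_ω(P)²`.
* §2 `compositeValuation_of_printFacts_of_pinnedTransfer` — the valuation currency
  `AcSelmer.XAc.HasCharValuationAt … n ∧ n = 2·(ord_p(1 − a_p + p) − 1 + ord_p log_ω P) − 2·ord_p c(Dt)` for
  every generator with `G(0) ≠ 0`, every good ordinary `p ≥ 3`, every class number.
The two-sided link / B₃^pin follow in the companion `…OfPrintFactsPinnedLink.lean`.

TREE-CURRENCY CAVEAT (unchanged, for the typer / referee): at torsion depth `δ ≥ 1` the identification of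
the tree's `heegnerModule D F` with Perrin-Riou's `Λ_K⁻·κ` is NOT a tree theorem (Howard 2004 Thm. 3.3.7
covers `p ∤ h_K`); `h59gp` is a HYPOTHESIS here, its typing ((T2)-general) a typer/referee decision.

References: [YanZhu2024MainConjNonCM] §5.2, Thm. 5.7 (1), Thm. 5.9 (arXiv:2412.20078v4 l.1189–1308);
[BurungaleCastellaKim2021] §1.1, Conj. 1.1, Thm. 4.1/5.2; [BurungaleCastellaSkinner2025] Prop. 4.2.2, Thm.
4.2.1 (proof); [CastellaGrossiLeeSkinner2022] Thm. 5.1.3; [PerrinRiou1987BSMF] §1 Conj. B, §3.4;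
[Mazur1978] (odd good `p ∤ c`); [Castella2018] Thm. 2.3, §5; [Carayol1986]; [Darmon2004] Prop. 3.11;
HOME/plan/findings/PIN-1-unpinned-heegner-family.md; HOME/REF-AUDIT.md REF-104.
-/

-- the summit and its single problem are both named `BirchSwinnertonDyer` (registry layout D-0017)
set_option linter.dupNamespace false
set_option autoImplicit false

noncomputable section

open scoped Classical

open PowerSeries WeierstrassCurve NumberField IsDedekindDomain Field
  Literature.NumberTheory.EllipticCurves Literature.NumberTheory.EllipticCurves.ModularForms
  Literature.NumberTheory.EllipticCurves.Rank1Residual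
  Literature.NumberTheory.EllipticCurves.Castella2018
  Literature.NumberTheory.EllipticCurves.YanZhu2026
  Literature.NumberTheory.EllipticCurves.CastellaGrossiLeeSkinner2022
  Summit.BirchSwinnertonDyer.Rank1Residual
  Summit.BirchSwinnertonDyer.Rank1Residual.X11b.Halves
  Summit.BirchSwinnertonDyer.Rank1Residual.X1.KellerYinHalves
  Summit.BirchSwinnertonDyer.Rank1Residual.X11b.YZComposite

namespace Summit.BirchSwinnertonDyer.BirchSwinnertonDyer.Cruxes.TwoSidedLinkAnyClassNumberX10b.CompositeTransferX10b

/-! ## §1 The composite at the trivial character, `¬ p ∣ h_K` DELETED, from the print facts and the transfer -/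

section Composite

/-- **PINNED form. Yan–Zhu 2026 Thm. 5.7 (1) + [Thm. 5.9, (2) ⟹ (1) at `S ⊂ Λˣ`, for families with
`p`-adic-unit Manin constant `¬ (p : ℤ) ∣ F.Dt.c`, read WITHOUT `p ∤ h_K`] + BCS 2025 Prop. 4.2.2 + CGLS
2022 Thm. 5.1.3 at the trivial character, GRANTED Howard's containment FOR A PINNED FAMILY
(`∃ jbar D F X, ¬ (p : ℤ) ∣ F.Dt.c ∧ heegnerCharIdeal D F ^ 2 ≤ char(torsion X.X)`, the hypothesis of the
WANTED fact (T1) of PIN-1) — the conclusion of (T1) AT EVERY CLASS NUMBER.** Verbatim the kernel derivation `X11b.YZComposite.thm57_thm59_bcs422_cgls513_of_heegnerDivisibility_of_printFacts`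
(ty1 g16) with its single use of `Thm57Hypotheses.not_dvd_classNumber` (the typed Thm. 5.9) replaced by
the explicit PINNED transfer hypothesis `h59gp` (Thm. 5.9's second bullet ⟹ first bullet at the
trivial localisation, for families with `¬ (p : ℤ) ∣ F.Dt.c`, on the binder list of
`thm57_isTorsion_charIdealXGr_eq_bdpLFunction` + `jbar` + `N = N_E`, NO class-number binder — Yan–Zhu's
§5.2 setting carries none; = (T2)-general of REF-104 read at `s = 1`). Per datum: Carayol (`hC`) gives `N = N_E`;
an embedding datum `ι'` inducing `v`; the frames `L₁` (5.7 (1): torsion, `p^k'·(F) ⊆ (L₁)`), `L₃` (`h59gp`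
fed with the pinned containment: `L₃ ∈ (F)`), `L₂` (4.2.2: a unit coefficient), `L₄` (5.1.3 at `τ_* P`) of the
SAME `(ι', v, κ, γ, f_E)` generate the same ideal / have the same constant term (frame rigidity
`X11b.R1.span_singleton_eq_of_isBDPLFunction`, `X11b.constantCoeff_eq_of_isBDPLFunction`); the
μ-comparison gives `(F)·R₀⟦T⟧ = (L₁)`; `(log τ_* P)² = (log P)²` (Darmon Prop. 3.11, discharged);
`F(0) = u'·V`. [cite: YanZhu2024MainConjNonCM, Thm. 5.7 (1) and Thm. 5.9 (arXiv:2412.20078v4 TeX l.1217–1227, l.1283–1293), §5.2 setting l.1189–1190, proof of Thm. 5.7 (l.1294–1308)]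
[cite: BurungaleCastellaSkinner2025, Prop. 4.2.2 (p. 9) and Thm. 4.2.1, proof (p. 8)]
[cite: CastellaGrossiLeeSkinner2022, Thm. 5.1.3] [cite: Carayol1986] [cite: Darmon2004, Prop. 3.11]
[cite: Castella2018, Thm. 3.1 (the frame `IsBDPLFunction`)] -/
theorem composite_of_printFacts_of_pinnedTransfer
    (h57 : thm57_isTorsion_charIdealXGr_eq_bdpLFunction)
    (h59gp : ∀ {p : ℕ} [Fact p.Prime] (ι' : PadicAlgCl p ≃+* ℂ) (W : WeierstrassCurve ℚ) [W.IsElliptic]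
      [W.IsGloballyMinimal] (K : Type) [Field K] [NumberField K] (v vbar : HeightOneSpectrum (𝓞 K))
      (κ : ZpExtension K p) (γ : absoluteGaloisGroup K) [Fact (κ.IsTopGenerator γ)] {N : ℕ} [NeZero N]
      {f : CuspForm (CongruenceSubgroup.Gamma0 N) 2} (jbar : AlgebraicClosure K →+* ℂ)
      (_ : IsNewformOf W f),
      N = W.conductorNorm ℤ → 3 ≤ p → GoodOrd W p → (W.baseChange K).HasIrreducibleModPGaloisRep p →
      IsImaginaryQuadratic K → SatisfiesHeegnerHypothesis N K →
        ((Ideal.span {(p : ℤ)}).primesOver (𝓞 K)).ncard = 2 →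
        Odd (NumberField.discr K) → NumberField.discr K ≠ -3 → κ.IsAnticyclotomic →
      (∀ (w : InfinitePlace K) (k : 𝓞 K), k ∈ v.asIdeal ↔ ‖ι'.symm (w.embedding (k : K))‖ < 1) →
        ((p : ℕ) : 𝓞 K) ∈ vbar.asIdeal → vbar ≠ v →
      ∃ (ΩK : ℂ) (Ωp : (unrIntegers p)ˣ) (L : UnrSeries p),
        ΩK ≠ 0 ∧ IsBDPLFunction ι' v κ γ f ΩK ((Ωp : unrIntegers p) : ℂ_[p]) L ∧
        ∀ (D : (W.baseChange K).LambdaAdicSelmerData κ γ) (F : HeegnerFamily N W K κ jbar)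
          (X : (W.baseChange K).SelmerDualData κ γ) (j : ℤ_[p] →+* unrIntegers p),
          ¬ (p : ℤ) ∣ F.Dt.c →
          (∀ x : ℤ_[p], ((j x : unrIntegers p) : ℂ_[p]) = algebraMap ℚ_[p] ℂ_[p] (x : ℚ_[p])) →
          heegnerCharIdeal D F ^ 2 ≤
              Module.charIdeal (IwasawaAlgebra p) (Submodule.torsion (IwasawaAlgebra p) X.X) →
            L ∈ (AcSelmer.XAc.charIdeal (W.baseChange K) p κ vbar ∅ γ).map (PowerSeries.map j))
    (h422 : BurungaleCastellaSkinner2025.prop422_exists_isBDPLFunction_mu_eq_zero)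
    (h513 : thm513_exists_isBDPLFunction_valueAtOne_disc)
    (hC : ∀ (N : ℕ) [NeZero N], IsNewformOf.level_eq_conductorNorm (N := N)) :
    ∀ (W : WeierstrassCurve ℚ) [W.IsElliptic] [W.IsGloballyMinimal] (p : ℕ) [Fact p.Prime],
      3 ≤ p → GoodOrd W p →
      ∀ (K : Type) [Field K] [NumberField K], IsImaginaryQuadratic K →
        SatisfiesHeegnerHypothesis (W.conductorNorm ℤ) K → SatisfiesHeegnerHypothesis p K →
        Odd (NumberField.discr K) → NumberField.discr K ≠ -3 →
        (W.baseChange K).HasIrreducibleModPGaloisRep p →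
      ∀ (ι : K →+* ℚ_[p]) (v vbar : HeightOneSpectrum (𝓞 K)),
        (∀ x : 𝓞 K, x ∈ v.asIdeal ↔ ‖ι (x : K)‖ < 1) →
        ((p : ℕ) : 𝓞 K) ∈ vbar.asIdeal → vbar ≠ v →
      ∀ (κ : ZpExtension K p), κ.IsAnticyclotomic →
      ∀ (γ : absoluteGaloisGroup K) [Fact (κ.IsTopGenerator γ)],
      ∀ (N : ℕ) [NeZero N] (Dt : ModularParametrizationData W N)
        (H : HeegnerDatum N (NumberField.discr K)) (ιC : K →+* ℂ) (P : (W.baseChange K).toAffine.Point),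
        WeierstrassCurve.Affine.Point.map ιC.toRatAlgHom P = heegnerPointComplex Dt H →
        (∃ (jbar : AlgebraicClosure K →+* ℂ) (D : (W.baseChange K).LambdaAdicSelmerData κ γ)
            (F : HeegnerFamily N W K κ jbar) (X : (W.baseChange K).SelmerDualData κ γ),
            ¬ (p : ℤ) ∣ F.Dt.c ∧ heegnerCharIdeal D F ^ 2 ≤
              Module.charIdeal (IwasawaAlgebra p) (Submodule.torsion (IwasawaAlgebra p) X.X)) →
        Module.IsTorsion (IwasawaAlgebra p) (AcSelmer.XAc (W.baseChange K) p κ vbar ∅ γ) ∧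
        ∃ F : IwasawaAlgebra p,
          AcSelmer.XAc.charIdeal (W.baseChange K) p κ vbar ∅ γ = Ideal.span {F} ∧
          ∃ u : ℤ_[p]ˣ,
            ((PowerSeries.constantCoeff F : ℤ_[p]) : ℚ_[p]) =
              ((u : ℤ_[p]) : ℚ_[p]) * ((Dt.c : ℚ_[p])⁻¹) ^ 2 *
                (1 - (W.frobeniusTrace p : ℚ_[p]) * (p : ℚ_[p])⁻¹ + (p : ℚ_[p])⁻¹) ^ 2 *
                ((W.baseChange ℚ_[p]).padicLogPoint (formalIndex W p • padicPointOf W p ι P) /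
                  (formalIndex W p : ℚ_[p])) ^ 2 := by
  intro W _ _ p _ hp hord K _ _ hK hHN hHp hodd h3 hirrK ι v vbar hv hvbar hne κ hκ γ _ N _ Dt H
    ιC P hP hHow
  have hpp : p.Prime := Fact.out
  have hp2 : p ≠ 2 := by omega
  have hp2' : 2 < p := by omega
  have hγ : κ.IsTopGenerator γ := Fact.out
  -- Carayol: the level of the parametrisation datum is the conductor
  have hNc : N = W.conductorNorm ℤ := hC N Dt.isNewformOf
  subst hNc
  -- `p ∈ v`, `p` split, `p ∤ N_E`, the embedding datum `ι'` inducing `v`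
  have hpv : ((p : ℕ) : 𝓞 K) ∈ v.asIdeal := by
    rw [hv, show ι (((p : ℕ) : 𝓞 K) : K) = (p : ℚ_[p]) by simp]
    exact Padic.norm_p_lt_one
  have hsplit : ((Ideal.span {(p : ℤ)}).primesOver (𝓞 K)).ncard = 2 := hHp p hpp (dvd_refl p)
  have hgood : W.HasGoodReductionAtPrime p := hord.1
  have hpN : ¬ p ∣ W.conductorNorm ℤ := fun h ↦
    (W.dvd_conductorNorm_iff_not_hasGoodReductionAtPrime p).mp h hgood
  obtain ⟨ι₀⟩ := PadicAlgCl.nonempty_ringEquiv_complex p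
  obtain ⟨ι', -, hι'⟩ := X11b.exists_datum_forall_mem_iff p ι₀ hK hpv
  -- frame 1: Thm. 5.7 (1) — torsion and the rational `⊆`
  obtain ⟨ΩK₁, Ωp₁, L₁, hΩK₁, hL₁, htors, hrat⟩ :=
    h57 ι' W K v vbar κ γ Dt.isNewformOf hp hord hirrK hK hHN hsplit hodd h3 hι' hvbar hne hκ
  obtain ⟨⟨-, k', hk'⟩, -⟩ := hrat (toUnr p) (coe_toUnr p)
  -- frame 3: the PINNED transfer (Thm. 5.9, (2) ⟹ (1) at `S ⊂ Λˣ`, `¬ p ∣ c(F.Dt)`, no class-number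
  -- binder) fed with Howard's containment for the pinned family — `L₃ ∈ ch·R₀⟦T⟧`
  obtain ⟨jbar, D, Fh, X, hpin, hle⟩ := hHow
  obtain ⟨ΩK₃, Ωp₃, L₃, hΩK₃, hL₃, hmem⟩ :=
    h59gp ι' W K v vbar κ γ jbar Dt.isNewformOf rfl hp hord hirrK hK hHN hsplit hodd h3 hκ hι' hvbar hne
  have hL₃mem := hmem D Fh X (toUnr p) hpin (coe_toUnr p) hle
  -- frame 2: Prop. 4.2.2 — a unit coefficient
  obtain ⟨ΩK₂, Ωp₂, L₂, hΩK₂, hL₂, hμ⟩ :=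
    h422 ι' W K v κ γ Dt.isNewformOf hp2' hgood hK hHN hsplit hodd h3 hirrK hpv hι' hκ hγ
  -- frame 4: Thm. 5.1.3 at `τ_* P`, read through THE infinite place
  obtain ⟨w₀⟩ := (inferInstance : Nonempty (InfinitePlace K))
  obtain ⟨τ, hP'⟩ := exists_algHom_map_map_eq hK ιC w₀ Dt H hP
  obtain ⟨ΩK₄, Ωp₄, L₄, hΩK₄, hL₄, u, hu⟩ :=
    h513 ι' W K v κ γ Dt H w₀ ι (WeierstrassCurve.Affine.Point.map (W' := W) τ P) hp2 hpN hK hsplit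
      hpv hι' hHN hodd h3 hκ hγ hP' hv
  -- frame rigidity: same ideal, same constant term
  have hΩp₁ := X11b.YZComposite.coe_units_ne_zero Ωp₁
  have hΩp₂ := X11b.YZComposite.coe_units_ne_zero Ωp₂
  have hΩp₃ := X11b.YZComposite.coe_units_ne_zero Ωp₃
  have hΩp₄ := X11b.YZComposite.coe_units_ne_zero Ωp₄
  have h21 : Ideal.span ({L₂} : Set (UnrSeries p)) = Ideal.span {L₁} :=
    X11b.R1.span_singleton_eq_of_isBDPLFunction hp2 hK hκ hγ hΩK₁ hΩK₂ hΩp₁ hΩp₂ hL₁ hL₂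
  have h31 : Ideal.span ({L₃} : Set (UnrSeries p)) = Ideal.span {L₁} :=
    X11b.R1.span_singleton_eq_of_isBDPLFunction hp2 hK hκ hγ hΩK₁ hΩK₃ hΩp₁ hΩp₃ hL₁ hL₃
  have h41 : PowerSeries.constantCoeff L₄ = PowerSeries.constantCoeff L₁ :=
    X11b.constantCoeff_eq_of_isBDPLFunction hp2 hK hκ hγ hΩK₁ hΩK₄ hΩp₁ hΩp₄ hL₁ hL₄
  -- a generator `F` of `ch_Λ(𝒳)`; the extended ideal is `(F')`, `F' = map toUnr F`
  obtain ⟨F, hF⟩ :=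
    (charIdeal_isPrincipal_holds p (Castella2018.AcSelmer.XAc (W.baseChange K) p κ vbar ∅ γ)).principal
  have hF' : Castella2018.AcSelmer.XAc.charIdeal (W.baseChange K) p κ vbar ∅ γ = Ideal.span {F} := hF
  set F' : UnrSeries p := PowerSeries.map (toUnr p) F with hF'def
  have hI : (Castella2018.AcSelmer.XAc.charIdeal (W.baseChange K) p κ vbar ∅ γ).map
      (PowerSeries.map (toUnr p)) = Ideal.span {F'} := by
    rw [hF', Ideal.map_span, Set.image_singleton]
  -- (1) `C(p^k') · F' ∈ (L₁)`
  have h1 : C ((p : unrIntegers p) ^ k') * F' ∈ Ideal.span ({L₁} : Set (UnrSeries p)) :=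
    hk' F' (by rw [hI]; exact Ideal.mem_span_singleton_self F')
  -- (2) `L₁ ∈ (F')`
  have h2 : L₁ ∈ Ideal.span ({F'} : Set (UnrSeries p)) := by
    have hL₁3 : L₁ ∈ Ideal.span ({L₃} : Set (UnrSeries p)) := by
      rw [h31]; exact Ideal.mem_span_singleton_self L₁
    rw [hI] at hL₃mem
    exact (Ideal.span_singleton_le_iff_mem _).mpr hL₃mem hL₁3
  -- (3) `μ(L₁) = 0`
  obtain ⟨n, hn⟩ := exists_firstUnitCoeffAt_of_span_eq h21 hμ
  -- the μ-comparison: `(F') = (L₁)`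
  have hspan : Ideal.span ({F'} : Set (UnrSeries p)) = Ideal.span {L₁} :=
    span_eq_of_C_pow_mul_mem_of_mem h1 h2 hn
  -- the value at `𝟙`, moved to `L₁` and to `P`
  have hlog : padicLogOmega W p ι (WeierstrassCurve.Affine.Point.map (W' := W) τ P) ^ 2 =
      padicLogOmega W p ι P ^ 2 :=
    sq_padicLogOmega_map_eq_of_isHeegnerPoint W hK hHN ι ⟨Dt, H, ιC, hP⟩ τ
  rw [hlog] at hu
  have hval : L₁.HasValueAt 0 (((u : unrIntegers p) : ℂ_[p]) *
      algebraMap ℚ_[p] ℂ_[p] (((Dt.c : ℚ_[p])⁻¹) ^ 2 *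
        (1 - (W.frobeniusTrace p : ℚ_[p]) * (p : ℚ_[p])⁻¹ + (p : ℚ_[p])⁻¹) ^ 2 *
        padicLogOmega W p ι P ^ 2)) := by
    have h0 := UnrSeries.hasValueAt_zero L₁
    rw [← h41, ← UnrSeries.eq_constantCoeff_of_hasValueAt_zero hu] at h0
    exact h0
  obtain ⟨u', hu'⟩ := exists_unit_constantCoeff_eq hspan u hval
  refine ⟨htors, F, hF', u', ?_⟩
  rw [hu']
  unfold padicLogOmega
  ring

end Composite

/-! ## §2 The composite in the valuation currency, every class number, every generator -/

section ValuationCurrency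

/-- **The PINNED class-number-free composite valuation identity** — granted the four print facts and the
pinned transfer `h59gp`: at every good ordinary `p ≥ 3` frame (Heegner for `N_E` and `p`, `d_K` odd `≠ −3`,
(irr_K), ANY class number), Howard's containment for a PINNED family (`¬ (p : ℤ) ∣ F.Dt.c`) and ONE generator `G` of `Char_Λ(𝒳_Gr)` with `G(0) ≠ 0` give
`AcSelmer.XAc.HasCharValuationAt … n` with `n = 2·(ord_p(1 − a_p + p) − 1 + ord_p log_ω P) − 2·ord_p c(Dt)`
(two generators differ by a unit of `Λ`, whose constant term is a unit of `ℤ_p`; then §0). The body of the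
cells' `X11b.IMCWaldspurgerOnTreeGoodAt` up to the Manin term, with NO image and NO class-number
hypothesis. [cite: YanZhu2024MainConjNonCM, Thm. 5.7 (1) and Thm. 5.9 (arXiv:2412.20078v4 l.1217–1223, l.1283–1293)]
[cite: BurungaleCastellaSkinner2025, Prop. 4.2.2 (p. 9)] [cite: CastellaGrossiLeeSkinner2022, Thm. 5.1.3]
[cite: Castella2018, §5 (eq:IMC+BDP) (arXiv:1704.06608 p. 12)] -/
theorem compositeValuation_of_printFacts_of_pinnedTransfer
    (h57 : thm57_isTorsion_charIdealXGr_eq_bdpLFunction)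
    (h59gp : ∀ {p : ℕ} [Fact p.Prime] (ι' : PadicAlgCl p ≃+* ℂ) (W : WeierstrassCurve ℚ) [W.IsElliptic]
      [W.IsGloballyMinimal] (K : Type) [Field K] [NumberField K] (v vbar : HeightOneSpectrum (𝓞 K))
      (κ : ZpExtension K p) (γ : absoluteGaloisGroup K) [Fact (κ.IsTopGenerator γ)] {N : ℕ} [NeZero N]
      {f : CuspForm (CongruenceSubgroup.Gamma0 N) 2} (jbar : AlgebraicClosure K →+* ℂ)
      (_ : IsNewformOf W f),
      N = W.conductorNorm ℤ → 3 ≤ p → GoodOrd W p → (W.baseChange K).HasIrreducibleModPGaloisRep p →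
      IsImaginaryQuadratic K → SatisfiesHeegnerHypothesis N K →
        ((Ideal.span {(p : ℤ)}).primesOver (𝓞 K)).ncard = 2 →
        Odd (NumberField.discr K) → NumberField.discr K ≠ -3 → κ.IsAnticyclotomic →
      (∀ (w : InfinitePlace K) (k : 𝓞 K), k ∈ v.asIdeal ↔ ‖ι'.symm (w.embedding (k : K))‖ < 1) →
        ((p : ℕ) : 𝓞 K) ∈ vbar.asIdeal → vbar ≠ v →
      ∃ (ΩK : ℂ) (Ωp : (unrIntegers p)ˣ) (L : UnrSeries p),
        ΩK ≠ 0 ∧ IsBDPLFunction ι' v κ γ f ΩK ((Ωp : unrIntegers p) : ℂ_[p]) L ∧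
        ∀ (D : (W.baseChange K).LambdaAdicSelmerData κ γ) (F : HeegnerFamily N W K κ jbar)
          (X : (W.baseChange K).SelmerDualData κ γ) (j : ℤ_[p] →+* unrIntegers p),
          ¬ (p : ℤ) ∣ F.Dt.c →
          (∀ x : ℤ_[p], ((j x : unrIntegers p) : ℂ_[p]) = algebraMap ℚ_[p] ℂ_[p] (x : ℚ_[p])) →
          heegnerCharIdeal D F ^ 2 ≤
              Module.charIdeal (IwasawaAlgebra p) (Submodule.torsion (IwasawaAlgebra p) X.X) →
            L ∈ (AcSelmer.XAc.charIdeal (W.baseChange K) p κ vbar ∅ γ).map (PowerSeries.map j))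
    (h422 : BurungaleCastellaSkinner2025.prop422_exists_isBDPLFunction_mu_eq_zero)
    (h513 : thm513_exists_isBDPLFunction_valueAtOne_disc)
    (hC : ∀ (N : ℕ) [NeZero N], IsNewformOf.level_eq_conductorNorm (N := N)) :
    ∀ (W : WeierstrassCurve ℚ) [W.IsElliptic] [W.IsGloballyMinimal] (p : ℕ) [Fact p.Prime],
      3 ≤ p → GoodOrd W p →
      ∀ (K : Type) [Field K] [NumberField K], IsImaginaryQuadratic K →
        SatisfiesHeegnerHypothesis (W.conductorNorm ℤ) K → SatisfiesHeegnerHypothesis p K →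
        Odd (NumberField.discr K) → NumberField.discr K ≠ -3 →
        (W.baseChange K).HasIrreducibleModPGaloisRep p →
      ∀ (ι : K →+* ℚ_[p]) (v vbar : HeightOneSpectrum (𝓞 K)),
        (∀ x : 𝓞 K, x ∈ v.asIdeal ↔ ‖ι (x : K)‖ < 1) →
        ((p : ℕ) : 𝓞 K) ∈ vbar.asIdeal → vbar ≠ v →
      ∀ (κ : ZpExtension K p), κ.IsAnticyclotomic →
      ∀ (γ : absoluteGaloisGroup K) [Fact (κ.IsTopGenerator γ)],
      ∀ (N : ℕ) [NeZero N] (Dt : ModularParametrizationData W N)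
        (H : HeegnerDatum N (NumberField.discr K)) (ιC : K →+* ℂ) (P : (W.baseChange K).toAffine.Point),
        WeierstrassCurve.Affine.Point.map ιC.toRatAlgHom P = heegnerPointComplex Dt H →
        (∃ (jbar : AlgebraicClosure K →+* ℂ) (D : (W.baseChange K).LambdaAdicSelmerData κ γ)
            (F : HeegnerFamily N W K κ jbar) (X : (W.baseChange K).SelmerDualData κ γ),
            ¬ (p : ℤ) ∣ F.Dt.c ∧ heegnerCharIdeal D F ^ 2 ≤
              Module.charIdeal (IwasawaAlgebra p) (Submodule.torsion (IwasawaAlgebra p) X.X)) →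
      ∀ (G : IwasawaAlgebra p),
        AcSelmer.XAc.charIdeal (W.baseChange K) p κ vbar ∅ γ = Ideal.span {G} →
        PowerSeries.constantCoeff G ≠ 0 →
        ∃ n : ℕ, AcSelmer.XAc.HasCharValuationAt (W.baseChange K) p κ vbar ∅ γ n ∧
          (n : ℤ) = 2 * ((padicValInt p (1 - W.frobeniusTrace p + p) : ℤ) - 1 +
            Literature.NumberTheory.EllipticCurves.padicLogOrd W p ι P) - 2 * (padicValInt p Dt.c : ℤ) := by
  intro W _ _ p _ hp hord K _ _ hK hHN hHp hodd h3 hirrK ι v vbar hv hvbar hne κ hκ γ _ N _ Dt H ιC P hP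
    hHow G hG hG0
  obtain ⟨htors, F, hF, u, hu⟩ := composite_of_printFacts_of_pinnedTransfer h57 h59gp h422 h513 hC W p hp hord K
    hK hHN hHp hodd h3 hirrK ι v vbar hv hvbar hne κ hκ γ N Dt H ιC P hP hHow
  -- `G = F · w` for a unit `w` of `Λ`; `w(0)` is a unit of `ℤ_p`
  obtain ⟨w, rfl⟩ := Ideal.span_singleton_eq_span_singleton.mp (hF.symm.trans hG)
  have hw : IsUnit (PowerSeries.constantCoeff (w : IwasawaAlgebra p)) :=
    PowerSeries.isUnit_constantCoeff _ w.isUnit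
  have hu' : ((PowerSeries.constantCoeff (F * (w : IwasawaAlgebra p)) : ℤ_[p]) : ℚ_[p]) =
      (((u * hw.unit : ℤ_[p]ˣ) : ℤ_[p]) : ℚ_[p]) * ((Dt.c : ℚ_[p])⁻¹) ^ 2 *
        (1 - (W.frobeniusTrace p : ℚ_[p]) * (p : ℚ_[p])⁻¹ + (p : ℚ_[p])⁻¹) ^ 2 *
        ((W.baseChange ℚ_[p]).padicLogPoint (formalIndex W p • padicPointOf W p ι P) /
          (formalIndex W p : ℚ_[p])) ^ 2 := by
    rw [map_mul, PadicInt.coe_mul, hu, Units.val_mul, PadicInt.coe_mul, IsUnit.unit_spec]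
    ring
  -- the left-hand side is non-zero, hence so is the right-hand side
  have hrhs : (((u * hw.unit : ℤ_[p]ˣ) : ℤ_[p]) : ℚ_[p]) * ((Dt.c : ℚ_[p])⁻¹) ^ 2 *
      (1 - (W.frobeniusTrace p : ℚ_[p]) * (p : ℚ_[p])⁻¹ + (p : ℚ_[p])⁻¹) ^ 2 *
      ((W.baseChange ℚ_[p]).padicLogPoint (formalIndex W p • padicPointOf W p ι P) /
        (formalIndex W p : ℚ_[p])) ^ 2 ≠ 0 := by
    rw [← hu']
    exact PadicInt.coe_ne_zero.2 hG0
  have hval := congrArg Padic.valuation hu'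
  rw [PadicInt.valuation_coe, valuation_unit_mul_bdpShape _ Dt.c (W.frobeniusTrace p) _ _ hrhs] at hval
  refine ⟨(PowerSeries.constantCoeff (F * (w : IwasawaAlgebra p))).valuation,
    AcSelmer.XAc.hasCharValuationAt_of_eq htors hG hG0 rfl, ?_⟩
  rw [hval, Literature.NumberTheory.EllipticCurves.padicLogOrd]

end ValuationCurrency

end Summit.BirchSwinnertonDyer.BirchSwinnertonDyer.Cruxes.TwoSidedLinkAnyClassNumberX10b.CompositeTransferX10b

end
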